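import Literature.MathematicalPhysics.QuantumFieldTheory.Balaban1983to89.BlockAveragingEMLLinearised
import Summits.QuantumFields.YangMills.Theorems.BalabanUVNodesN18CondIKRow
import HarnessLib

/-!
# Route `UnitScaleTilt`, crux K1 «MinimiserStabilityRegPr» (stmt-QuantumFields-19200), leaf V2′ — pillar P0 `Localise150`, the OPEN HALF (`L ∈ {3,5}`), step (1) of
# UV3-NODE §27.7: **THE LINEARISED (0.4)-AVERAGE IS FLUX-EXACT — around a coarse plaquette the comb terms cancel and the straight terms are the `L²`-fold block
# average of the fine plaquette circulations**

Cell `ym3-torus`, seat `ym3-torus-p1` g18.  The k-uniform multi-level plaquette smallness of the (0.4)-descent is in the tree only for `L ≥ 7` (`IterPlaqSmall`, p532781: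
the transport-defect recursion grows by `L + 1.05(d+2)L` per level against the allowed `L²`, because the crude comb comparison cannot see that the comb fluxes cancel
around a closed coarse plaquette).  This file records the cancellation at FIRST ORDER, exactly: for every bond field `A` (values in any real vector space) and every
coarse plaquette `p′ = (y; μ, ν)` of `T^{(j+1)}`:
* §1–§2 the ABELIAN LATTICE STOKES THEOREM for straight-segment sums: the circulation of `A` around the `m × n` rectangle at `x` is the sum of the `m·n` unit plaquette
  circulations inside (`rect_stokes`; `segSum` algebra only);
* §3 the four straight block averages around `p′` are the block average of the `L × L` rectangle circulations: `Σ_{c ∈ ∂p′} ±(QA)(c) = L^{−(d+1)}·Σ_{x ∈ B(y)} A(∂□_L(x))`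
  (`sum_bondAvg_plaq`; `B(y + e_μ) = B(y) + Le_μ`, `blockSite_shift`);
* §4 for the LINEARISED (0.4) average `Q₁ = L·Q − dλ̄` (`linAvg_eq_bondAvg_sub_grad_combMean`) the comb means `λ̄` CANCEL around the closed plaquette, so
  `Σ_{c ∈ ∂p′} ±(Q₁Y)(c) = L·L^{−(d+1)}·Σ_{x ∈ B(y)} Σ_{s,t < L} Y(∂p(x + se_μ + te_ν))` (`sum_linAvg_plaq_eq_fluxes`) and hence
  **`‖Σ_{c ∈ ∂p′} ±(Q₁Y)(c)‖ ≤ L²·max_p ‖Y(∂p)‖`** (`norm_sum_linAvg_plaq_le`) — coefficient EXACTLY `L²` (the area), no comb length `(d+2)L`.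
This is the first-order input of the all-`L` recursion `a_{i+1} ≤ L²a_i + C(L)a_i²` of §27.7 (second order: `Prop8Chart` `ChartOneStep`; gauge: the block axial gauge).
Theorems only; nothing of Bałaban's asserted.  NOT a claim about the mass gap.

References: T. Bałaban, CMP **98** (1985) 17–51 [Balaban1985Averaging] ((124)–(125) p.36, (62) p.28, Prop. 1 (51) p.26); CMP **95** (1984) 17–40
[Balaban1984PropagatorsI] ((1.8)–(1.11) p.19); CMP **102** (1985) 277–309 [Balaban1985Variational] ((146) p.301).
-/

noncomputable section

open scoped BigOperators

namespace Summit.QuantumFields.YangMills.Theorems.LinAvgFluxExact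

open Literature.MathematicalPhysics.QuantumFieldTheory.Balaban1983to89
open T4Continuum BlockAveraging BlockAveragingEMLLinearised LatticeFieldCalculus
open B5Eq118OneStroke (runSite_add segSum_add)
open BlockAveragingEMLProp2 (shift_shift_comm)
open YMDAG.N18.CondIKRow (runSite_runSite_comm)

variable {P : Params} {j : ℕ} {V : Type*} [AddCommGroup V]

/-! ## §1 Straight-segment sums -/

/-- one more bond at the end of a straight contour. [cite: Balaban1984PropagatorsI, (1.8) p.19] -/
theorem segSum_succ (A : VecField P j V) (x : Site P j) (μ : Fin P.d) (n : ℕ) :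
    segSum A x μ (n + 1) = segSum A x μ n + A (runBond x μ n) := by
  rw [segSum, Finset.sum_range_succ, ← segSum]

/-- a straight contour of one bond. [cite: Balaban1984PropagatorsI, (1.8) p.19] -/
theorem segSum_one (A : VecField P j V) (x : Site P j) (μ : Fin P.d) : segSum A x μ 1 = A ⟨x, μ⟩ := by
  rw [show (1 : ℕ) = 0 + 1 from rfl, segSum_succ]
  simp [segSum, runBond, runSite_zero]

/-! ## §2 Rectangle circulations and the abelian lattice Stokes theorem -/

/-- cutting the `(m+1) × n` rectangle at `x` into the `m × n` rectangle at `x` and the `1 × n` rectangle at `x + me_μ` (the shared side cancels).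
[cite: Balaban1984PropagatorsI, (1.9) p.19] -/
theorem rect_succ_left (A : VecField P j V) (x : Site P j) (μ ν : Fin P.d) (m n : ℕ) :
    segSum A x μ (m + 1) + segSum A (runSite x μ (m + 1)) ν n - segSum A (runSite x ν n) μ (m + 1) - segSum A x ν n =
      (segSum A x μ m + segSum A (runSite x μ m) ν n - segSum A (runSite x ν n) μ m - segSum A x ν n) +
      (segSum A (runSite x μ m) μ 1 + segSum A (runSite (runSite x μ m) μ 1) ν n
        - segSum A (runSite (runSite x μ m) ν n) μ 1 - segSum A (runSite x μ m) ν n) := by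
  rw [segSum_add A x μ m 1, segSum_add A (runSite x ν n) μ m 1, runSite_add, runSite_runSite_comm x ν μ n m]
  abel

/-- the `m × n` rectangle circulation is the sum of the `m` circulations of the `1 × n` strips. [cite: Balaban1984PropagatorsI, (1.9) p.19] -/
theorem rect_sum_left (A : VecField P j V) (x : Site P j) (μ ν : Fin P.d) (n : ℕ) : ∀ m : ℕ,
    segSum A x μ m + segSum A (runSite x μ m) ν n - segSum A (runSite x ν n) μ m - segSum A x ν n =
      ∑ s ∈ Finset.range m, (segSum A (runSite x μ s) μ 1 + segSum A (runSite (runSite x μ s) μ 1) ν n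
        - segSum A (runSite (runSite x μ s) ν n) μ 1 - segSum A (runSite x μ s) ν n)
  | 0 => by simp [segSum, runSite_zero]
  | m + 1 => by rw [rect_succ_left, rect_sum_left A x μ ν n m, Finset.sum_range_succ]

/-- cutting the `1 × (n+1)` strip into the `1 × n` strip and the unit plaquette at `x + ne_ν`. [cite: Balaban1984PropagatorsI, (1.9) p.19] -/
theorem strip_succ (A : VecField P j V) (x : Site P j) (μ ν : Fin P.d) (n : ℕ) :
    segSum A x μ 1 + segSum A (runSite x μ 1) ν (n + 1) - segSum A (runSite x ν (n + 1)) μ 1 - segSum A x ν (n + 1) =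
      (segSum A x μ 1 + segSum A (runSite x μ 1) ν n - segSum A (runSite x ν n) μ 1 - segSum A x ν n) +
      (segSum A (runSite x ν n) μ 1 + segSum A (runSite (runSite x ν n) μ 1) ν 1
        - segSum A (runSite (runSite x ν n) ν 1) μ 1 - segSum A (runSite x ν n) ν 1) := by
  rw [segSum_add A (runSite x μ 1) ν n 1, segSum_add A x ν n 1, runSite_add, runSite_runSite_comm x μ ν 1 n]
  abel

/-- the `1 × n` strip circulation is the sum of its `n` unit plaquette circulations. [cite: Balaban1984PropagatorsI, (1.9) p.19] -/
theorem strip_sum (A : VecField P j V) (x : Site P j) (μ ν : Fin P.d) : ∀ n : ℕ,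
    segSum A x μ 1 + segSum A (runSite x μ 1) ν n - segSum A (runSite x ν n) μ 1 - segSum A x ν n =
      ∑ t ∈ Finset.range n, (segSum A (runSite x ν t) μ 1 + segSum A (runSite (runSite x ν t) μ 1) ν 1
        - segSum A (runSite (runSite x ν t) ν 1) μ 1 - segSum A (runSite x ν t) ν 1)
  | 0 => by simp [segSum, runSite_zero]
  | n + 1 => by rw [strip_succ, strip_sum A x μ ν n, Finset.sum_range_succ]

/-- **ABELIAN LATTICE STOKES**: the circulation of a bond field around the `m × n` rectangle at `x` (sides `me_μ`, `ne_ν`) is the sum of the unit plaquette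
circulations `A⟨z,μ⟩ + A⟨z+e_μ,ν⟩ − A⟨z+e_ν,μ⟩ − A⟨z,ν⟩` over `z = x + se_μ + te_ν`, `s < m`, `t < n`. [cite: Balaban1984PropagatorsI, (1.9) p.19] -/
theorem rect_stokes (A : VecField P j V) (x : Site P j) (μ ν : Fin P.d) (m n : ℕ) :
    segSum A x μ m + segSum A (runSite x μ m) ν n - segSum A (runSite x ν n) μ m - segSum A x ν n =
      ∑ s ∈ Finset.range m, ∑ t ∈ Finset.range n,
        (A ⟨runSite (runSite x μ s) ν t, μ⟩ + A ⟨runSite (runSite (runSite x μ s) ν t) μ 1, ν⟩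
          - A ⟨runSite (runSite (runSite x μ s) ν t) ν 1, μ⟩ - A ⟨runSite (runSite x μ s) ν t, ν⟩) := by
  rw [rect_sum_left]
  refine Finset.sum_congr rfl fun s _ => ?_
  rw [strip_sum]
  refine Finset.sum_congr rfl fun t _ => ?_
  simp only [segSum_one]

/-! ## §3 The four straight block averages around a coarse plaquette -/

section Avg

variable [Module ℝ V]

/-- `B(y + e_μ) = B(y) + Le_μ` on the offset parametrisation: `blockSite (y + e_μ) r = blockSite y r + Le_μ` (standing range). [cite: Balaban1987RG1, (0.3) p.252] -/
theorem blockSite_shift (hj : j + 1 ≤ P.m + P.K) (y : Site P (j + 1)) (r : Fin P.d → Fin P.L) (μ : Fin P.d) :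
    Site.blockSite (y.shift μ) r = runSite (Site.blockSite y r) μ P.L := by
  funext κ
  by_cases hκ : κ = μ
  · subst hκ
    simp only [Site.blockSite, Site.shift, Function.update_self, runSite]
    rw [AveragingRT.cast_succ_mul_L hj]
    push_cast
    ring
  · simp [Site.blockSite, Site.shift, runSite, Function.update_of_ne hκ]

/-- **`Σ_{c ∈ ∂p′} ±(QA)(c) = L^{−(d+1)}·Σ_{x ∈ B(y)} A(∂□_L(x))`**: the straight block averages ([Balaban1984PropagatorsI] (1.11)) around the coarse plaquette `(y; μ, ν)` are the
block average of the circulations of `A` around the `L × L` squares based at the sites of `B(y)`. [cite: Balaban1984PropagatorsI, (1.11) p.19] -/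
theorem sum_bondAvg_plaq (hj : j + 1 ≤ P.m + P.K) (A : VecField P j V) (y : Site P (j + 1)) (μ ν : Fin P.d) :
    bondAvg A ⟨y, μ⟩ + bondAvg A ⟨y.shift μ, ν⟩ - bondAvg A ⟨y.shift ν, μ⟩ - bondAvg A ⟨y, ν⟩ =
      (((P.L : ℝ) ^ (P.d + 1))⁻¹) • ∑ r : Fin P.d → Fin P.L,
        (segSum A (Site.blockSite y r) μ P.L + segSum A (runSite (Site.blockSite y r) μ P.L) ν P.L
          - segSum A (runSite (Site.blockSite y r) ν P.L) μ P.L - segSum A (Site.blockSite y r) ν P.L) := by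
  simp only [bondAvg, blockSite_shift hj, ← smul_add, ← smul_sub, ← Finset.sum_add_distrib, ← Finset.sum_sub_distrib]

end Avg

/-! ## §4 The linearised (0.4) average: the comb means cancel around the plaquette -/

section Lin

variable {n : Type*}

/-- **THE COMB MEANS CANCEL AROUND A CLOSED COARSE PLAQUETTE**: for the linearised (0.4) average `Q₁ = L·Q − dλ̄` ([Balaban1985Averaging] (124)–(125), tree
`linAvg_eq_bondAvg_sub_grad_combMean`), `Σ_{c ∈ ∂p′} ±(Q₁Y)(c) = L·Σ_{c ∈ ∂p′} ±(QY)(c)` — the coarse pure gauge `dλ̄` is exact around the loop.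
[cite: Balaban1985Averaging, (124)-(125) p.36, (62) p.28] -/
theorem sum_linAvg_plaq (Y : PBond P j → Matrix n n ℂ) (y : Site P (j + 1)) (μ ν : Fin P.d) :
    linAvg Y ⟨y, μ⟩ + linAvg Y ⟨y.shift μ, ν⟩ - linAvg Y ⟨y.shift ν, μ⟩ - linAvg Y ⟨y, ν⟩ =
      ((P.L : ℕ) : ℂ) • (bondAvg Y ⟨y, μ⟩ + bondAvg Y ⟨y.shift μ, ν⟩ - bondAvg Y ⟨y.shift ν, μ⟩ - bondAvg Y ⟨y, ν⟩) := by
  simp only [linAvg_eq_bondAvg_sub_grad_combMean, PBond.tgt]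
  rw [shift_shift_comm y μ ν, smul_sub, smul_sub, smul_add]
  abel

/-- **FLUX-EXACTNESS OF THE LINEARISED (0.4) AVERAGE**: `Σ_{c ∈ ∂p′} ±(Q₁Y)(c) = L·L^{−(d+1)}·Σ_{x ∈ B(y)} Σ_{s,t<L} Y(∂p(x + se_μ + te_ν))` — the linearised coarse
plaquette flux is `L²` times the AVERAGE of the `L^d·L²` fine plaquette circulations of the squares `□_L(x)`, `x ∈ B(y)` (standing range `j + 1 ≤ m + K`).
[cite: Balaban1985Averaging, (124)-(125) p.36, Prop. 1 (51) p.26; Balaban1984PropagatorsI, (1.9)-(1.11) p.19] -/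
theorem sum_linAvg_plaq_eq_fluxes (hj : j + 1 ≤ P.m + P.K) (Y : PBond P j → Matrix n n ℂ) (y : Site P (j + 1)) (μ ν : Fin P.d) :
    linAvg Y ⟨y, μ⟩ + linAvg Y ⟨y.shift μ, ν⟩ - linAvg Y ⟨y.shift ν, μ⟩ - linAvg Y ⟨y, ν⟩ =
      ((P.L : ℕ) : ℂ) • ((((P.L : ℝ) ^ (P.d + 1))⁻¹) • ∑ r : Fin P.d → Fin P.L, ∑ s ∈ Finset.range P.L, ∑ t ∈ Finset.range P.L,
        (Y ⟨runSite (runSite (Site.blockSite y r) μ s) ν t, μ⟩ + Y ⟨runSite (runSite (runSite (Site.blockSite y r) μ s) ν t) μ 1, ν⟩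
          - Y ⟨runSite (runSite (runSite (Site.blockSite y r) μ s) ν t) ν 1, μ⟩ - Y ⟨runSite (runSite (Site.blockSite y r) μ s) ν t, ν⟩)) := by
  rw [sum_linAvg_plaq, sum_bondAvg_plaq hj]
  congr 2
  exact Finset.sum_congr rfl fun r _ => rect_stokes Y (Site.blockSite y r) μ ν P.L P.L

end Lin

/-! ## §5 The `L²` bound -/

section Bound

open scoped Matrix.Norms.L2Operator

variable {n : Type*} [Fintype n] [DecidableEq n]

/-- **`‖Σ_{c ∈ ∂p′} ±(Q₁Y)(c)‖ ≤ L²·f`** whenever every fine unit plaquette circulation of `Y` is bounded by `f` in norm — the coefficient is the AREA `L²`, with no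
comb-length factor (standing range `j + 1 ≤ m + K`). [cite: Balaban1985Averaging, Prop. 1 (51) p.26, (124)-(125) p.36; Balaban1985Variational, (146) p.301] -/
theorem norm_sum_linAvg_plaq_le (hj : j + 1 ≤ P.m + P.K) (Y : PBond P j → Matrix n n ℂ) (y : Site P (j + 1)) (μ ν : Fin P.d) {f : ℝ}
    (h : ∀ z : Site P j, ‖Y ⟨z, μ⟩ + Y ⟨runSite z μ 1, ν⟩ - Y ⟨runSite z ν 1, μ⟩ - Y ⟨z, ν⟩‖ ≤ f) :
    ‖linAvg Y ⟨y, μ⟩ + linAvg Y ⟨y.shift μ, ν⟩ - linAvg Y ⟨y.shift ν, μ⟩ - linAvg Y ⟨y, ν⟩‖ ≤ (P.L : ℝ) ^ 2 * f := by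
  rw [sum_linAvg_plaq_eq_fluxes hj]
  have hL0 : (0 : ℝ) < P.L := Nat.cast_pos.mpr P.L_pos
  have hLd : (0 : ℝ) < (P.L : ℝ) ^ (P.d + 1) := by positivity
  -- the triple sum has `L^d·L·L` terms, each `≤ f`
  have hsum : ‖∑ r : Fin P.d → Fin P.L, ∑ s ∈ Finset.range P.L, ∑ t ∈ Finset.range P.L,
      (Y ⟨runSite (runSite (Site.blockSite y r) μ s) ν t, μ⟩ + Y ⟨runSite (runSite (runSite (Site.blockSite y r) μ s) ν t) μ 1, ν⟩
        - Y ⟨runSite (runSite (runSite (Site.blockSite y r) μ s) ν t) ν 1, μ⟩ - Y ⟨runSite (runSite (Site.blockSite y r) μ s) ν t, ν⟩)‖ ≤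
      (P.L : ℝ) ^ P.d * ((P.L : ℝ) * ((P.L : ℝ) * f)) := by
    refine (norm_sum_le _ _).trans ?_
    have h1 : ∀ r : Fin P.d → Fin P.L, ‖∑ s ∈ Finset.range P.L, ∑ t ∈ Finset.range P.L,
        (Y ⟨runSite (runSite (Site.blockSite y r) μ s) ν t, μ⟩ + Y ⟨runSite (runSite (runSite (Site.blockSite y r) μ s) ν t) μ 1, ν⟩
          - Y ⟨runSite (runSite (runSite (Site.blockSite y r) μ s) ν t) ν 1, μ⟩ - Y ⟨runSite (runSite (Site.blockSite y r) μ s) ν t, ν⟩)‖ ≤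
        (P.L : ℝ) * ((P.L : ℝ) * f) := by
      intro r
      refine (norm_sum_le _ _).trans ?_
      have h2 : ∀ s ∈ Finset.range P.L, ‖∑ t ∈ Finset.range P.L,
          (Y ⟨runSite (runSite (Site.blockSite y r) μ s) ν t, μ⟩ + Y ⟨runSite (runSite (runSite (Site.blockSite y r) μ s) ν t) μ 1, ν⟩
            - Y ⟨runSite (runSite (runSite (Site.blockSite y r) μ s) ν t) ν 1, μ⟩ - Y ⟨runSite (runSite (Site.blockSite y r) μ s) ν t, ν⟩)‖ ≤ (P.L : ℝ) * f := by
        intro s _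
        refine (norm_sum_le _ _).trans ?_
        have := Finset.sum_le_sum (s := Finset.range P.L) fun t _ => h (runSite (runSite (Site.blockSite y r) μ s) ν t)
        refine this.trans ?_
        rw [Finset.sum_const, Finset.card_range, nsmul_eq_mul]
      refine (Finset.sum_le_sum h2).trans ?_
      rw [Finset.sum_const, Finset.card_range, nsmul_eq_mul]
    refine (Finset.sum_le_sum fun r _ => h1 r).trans ?_
    rw [Finset.sum_const, Finset.card_univ, Fintype.card_fun, Fintype.card_fin, Fintype.card_fin, nsmul_eq_mul]
    push_cast
    rfl
  rw [norm_smul, norm_smul, norm_inv, Complex.norm_natCast, Real.norm_eq_abs, abs_of_pos hLd]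
  calc (P.L : ℝ) * (((P.L : ℝ) ^ (P.d + 1))⁻¹ * ‖_‖) ≤ (P.L : ℝ) * (((P.L : ℝ) ^ (P.d + 1))⁻¹ * ((P.L : ℝ) ^ P.d * ((P.L : ℝ) * ((P.L : ℝ) * f)))) :=
        mul_le_mul_of_nonneg_left (mul_le_mul_of_nonneg_left hsum (by positivity)) hL0.le
    _ = (P.L : ℝ) ^ 2 * f := by field_simp; ring

end Bound

end Summit.QuantumFields.YangMills.Theorems.LinAvgFluxExact

end
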